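import Summits.HodgeConjecture.HodgeConjecture.Theses.BoundaryReadout
import Literature.AlgebraicGeometry.HodgeTheory.AbsoluteHodgeClasses
import Literature.AlgebraicGeometry.HodgeTheory.HodgeTypeExteriorProduct
import Literature.AlgebraicGeometry.Motives.BaseChangeProofs
import Literature.AlgebraicGeometry.Motives.CyclesBaseChange
import Literature.AlgebraicGeometry.Motives.CurveNet
import Summits.HodgeConjecture.HodgeConjecture.Theorems.BoundaryReadoutBoundaryAbsolutenessStubRationalDescent
import Summits.HodgeConjecture.HodgeConjecture.Theorems.BoundaryReadoutBoundaryAbsolutenessStubTypeDescent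
import Summits.HodgeConjecture.HodgeConjecture.Theorems.BoundaryReadoutBoundaryAbsolutenessStubVanishingPropagation
import Summits.HodgeConjecture.HodgeConjecture.Theorems.BoundaryReadoutBoundaryAbsolutenessStubSmoothFibreLocus
import Summits.HodgeConjecture.HodgeConjecture.Theorems.BoundaryReadoutBoundaryAbsolutenessStubConjugateFibre

/-!
# Line `typewise_readout` for the crux `BoundaryAbsoluteness` (stmt-HodgeConjecture-15913),
# route `BoundaryReadout` — TYPEWISE BOUNDARY READOUT, consolidated (crux-strategist, 2026-08-17, v2)

`BoundaryAbsoluteness` (rank 3 of `BoundaryReadout`; decl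
`Summit.HodgeConjecture.HodgeConjecture.Theses.BoundaryReadout.BoundaryAbsoluteness`): for
`f : 𝒳 ⟶ C` (𝒳 smooth projective of dimension `N`, `C` a smooth projective curve, `f` surjective),
`o ∈ C(ℂ)`, finitely many smooth projective `g_i : Y_i ⟶ X_o` JOINTLY COVERING the fibre, and a
rational `(p,p)` class `ξ ∈ H²ᵖ(𝒳(ℂ); ℂ)` whose restrictions `ξ|Y_i` are all absolute Hodge:
`ξ|X_t` is absolute Hodge on every smooth projective fibre `X_t`.

## The lever (relative to the earlier registered line `Lines/birth.lean`)

`birth` = conjugates EXIST · conjugation NATURAL · **σ preserves `Fᵖ`** (filtered algebraic/analytic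
de Rham comparison — inexpressible on the tree's AFFINE conjugation charts, birth.md) · rationality
readout. THIS LINE deletes the `Fᵖ` input: the boundary readout `H(𝒳^σ) → H(X_t^σ)` modulo
`ker(H(𝒳^σ) → ⊕ H(Y_i^σ))` is `ℂ`-LINEAR and the restriction maps commute with the Hodge-type
projectors of the conjugate varieties (pull-backs preserve types, `IsOfHodgeType.map_of_isSmoothProjective`,
PROVED; type pieces form an internal direct sum, `HodgeModel.isInternal_typePiece` / `typeProj` /
`sum_typeProj` / `typeProj_eq_of_sum_eq`, PROVED). Hence the SAME kernel inclusion transports the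
Hodge BIGRADING and not only the `ℚ`-structure: if the restrictions of a complex class `Θ` on `𝒳^σ` to
the pieces are of type `(p,p)`, every other type component of `Θ` dies on the pieces, hence on
`X_t^σ`, so `Θ|X_t^σ` is of type `(p,p)`. `σ` then enters ONLY through existence + naturality of
conjugates — the minimum certified by the landed Negative lemmas. NOT claimed (false in general):
that `Θ = (2πi/σ(2πi))^{-p} ξ^σ` is of type `(p,p)` on `𝒳^σ`.

## v3 (line lead prover-line-stmt-HodgeConjecture-15913-0, 2026-08-17): stub 5 split and ALL σ-free stubs LANDED

`stub_fibreKernelInclusion` is now the PROVED theorem `fibreKernelInclusion_of` from three registered stubs —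
`stub_conjugateFibre` (σ-bookkeeping: conjugate fibres / conjugate coverings; LANDED p167082),
`stub_smoothFibreLocus` (scheme theory: the smooth-fibre locus `W ⊆ C`, EGA IV 17.5.1 + Hartshorne
III.9.7; LANDED p166992), `stub_vanishingPropagation` (topology: Hodge III 8.2.7 + tube + Ehresmann over
`W` + connectedness/density; LANDED p166658) — and `stub_rationalDescent` (p166041), `stub_typeDescent`
(p165961) are landed too: the `sorry`s left are exactly the σ-INFRASTRUCTURE stubs 1–2, which are the
named Literature facts (J)(G)(C) of `ConjugationChartExistence` (stub 1 = `exists_isConjugateClass_of_facts'`)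
and `chartConjugation_canonical` of `ConjugationChartUniqueness` (stub 2). The assembled conditional
closing term is `Theorems/BoundaryReadoutBoundaryAbsoluteness.boundaryAbsoluteness_of_facts` (p168388).

## The cut (v2: five registered stubs; v2 consolidates the census's arithmetic ⟂ topology split)

* σ-INFRASTRUCTURE (shared verbatim with `birth` and `Cruxes/HCOverNumberFields/Lines/birth.lean`):
  `stub_conjugate_exists`, `stub_conjugateNaturality`.
* LINEAR ALGEBRA on ONE smooth projective variety (σ-free, curve-free; provable today from tree
  lemmas): `stub_rationalDescent` — rationality descends along a kernel inclusion
  `⋂ ker h_i^* ⊆ ker w^*` (rational lift along the pieces, finite-dimensionality); `stub_typeDescent`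
  — Hodge type `(a,b)` descends along the same kernel inclusion (type projectors). THE LEVER.
* TOPOLOGY (σ enters only as "the conjugate family is again such a family"; provable today):
  `stub_fibreKernelInclusion` — on every conjugate `f^σ : 𝒳^σ ⟶ C^σ` of the crux's family a complex
  class killed by the conjugate covering pieces of `X_o^σ` is killed by every smooth projective
  fibre (Hodge III 8.2.7 PROVED `Deligne1974_ker_pullback_eq_ker_pullback_resolution_holds` + tube
  by properness + flatness of restricted global classes over the connected smooth locus,
  `FibreRestrictionsLocallyConstantRank`, Ehresmann `ComplexPointsEhresmann`).
* `kernelDescent_of` — stubs 1–4 give the census's ARITHMETIC statement `KernelDescent`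
  ("absoluteness descends along conjugation-stable kernel inclusions"), sorry-free;
  `BoundaryAbsoluteness_of` — `KernelDescent` + stub 5 give the crux BY NAME (pure logic),
  sorry-free, axioms standard; `BoundaryAbsoluteness_of_stubs`.

Disproof used: none on file (`ledger crux ls stmt-HodgeConjecture-15913`: no `Disproof.lean`;
`ledger negatives --problem HodgeConjecture`: nothing on absolute Hodge classes / degenerations;
the sibling `Cruxes/BallQuotientHodgeAbsolute/Disproof.lean` only locates the chart obligations).
Landed Negative lemmas CHECKED AGAINST (`Theorems/BallQuotientHodgeAbsolute/Negative/*`):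
`nonempty_conjugationChart_of_isAbsoluteHodgeClass` (charts for `X_t` must be BUILT): honoured at
STUB 1; `conjugates_unique_of_forall_rational` (the conclusion certifies single-valued conjugation on
`ξ|X_t`): honoured at STUB 2; `eq_zero_of_forall_isOfHodgeType_isAbsoluteHodgeClass` (rationality is
load-bearing): STUB 3 concludes rationality only from rationality, STUB 4 type only from type. No
stub is an instance those lemmas refute. HC-safety of the crux: `HCSafe.lean` (census).
-/

noncomputable section

namespace Summit.HodgeConjecture.HodgeConjecture.Cruxes.BoundaryAbsoluteness.TypewiseReadout

open CategoryTheory AlgebraicGeometry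
open Literature.AlgebraicGeometry.Motives Literature.AlgebraicGeometry.HodgeTheory
open Summit.HodgeConjecture.HodgeConjecture.Theses.BoundaryReadout (BoundaryAbsoluteness)

/-! ### The five statements of the line (named; the stubs below assert them verbatim) -/

/-- STATEMENT 1 — **conjugates exist** on smooth projective complex varieties (VERBATIM statement 1
of `Lines/birth.lean`; theorem in print: Jouanolou torsor + GAGA + de Rham + Grothendieck's
comparison on the affine chart). [cite: Jouanolou1973, Lemme 1.5] [cite: Grothendieck1966, Thm. 1']
[cite: CharlesSchnell2014Notes, §11.2.2 (11.2.2)–(11.2.3)] -/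
def ConjugateExists : Prop :=
  ∀ ⦃n : ℕ⦄ ⦃X : SchemeOver ℂ⦄, IsSmoothProjective n X →
    ∀ (σ : ℂ ≃+* ℂ) (k : ℕ) (c : complexBetti X k), ∃ c', IsConjugateClass σ X k c c'

/-- STATEMENT 2 — **conjugation is natural** (commutes with pull-backs along morphisms of smooth
projective varieties and is single-valued; VERBATIM statement 2 of `Lines/birth.lean`).
[cite: CharlesSchnell2014Notes, §11.2.2 (11.2.2)–(11.2.3)] [cite: Grothendieck1966, Thm. 1'] -/
def ConjugateNaturality : Prop :=
  ∀ ⦃m n : ℕ⦄ ⦃Y X : SchemeOver ℂ⦄, IsSmoothProjective m Y → IsSmoothProjective n X →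
    ∀ (g : Y ⟶ X) (σ : ℂ ≃+* ℂ) (k : ℕ) (c : complexBetti X k)
      (c' : complexBetti (conjugateVariety σ X) k) (d' : complexBetti (conjugateVariety σ Y) k),
      IsConjugateClass σ X k c c' → IsConjugateClass σ Y k (complexBetti.map g k c) d' →
        d' = complexBetti.map (conjHom σ g) k c'

/-- STATEMENT 3 — **rationality descends along a kernel inclusion** (σ-free, curve-free linear
algebra on ONE smooth projective `X`): for `h_i : Y_i ⟶ X` (finitely many) and `w : W ⟶ X` with
`⋂ᵢ ker h_i^* ⊆ ker w^*` on `Hᵏ(X(ℂ); ℂ)`, a complex class `Θ` whose pull-backs `h_i^* Θ` are all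
rational has `w^* Θ` rational. Printed content: `Hᵏ(X(ℂ); ℚ)` is a finite-dimensional `ℚ`-form
(tree: `finite_singularHomology_rat_complexPoints`), the `h_i^*` are defined over `ℚ`, so `Θ` agrees on
the pieces with a RATIONAL `θ₀` (Deligne 1982, Lemma 2.13: `(V ⊗ Z) ∩ W = V`; family version of the
tree's `exists_isRationalClass_complexBetti_map_eq`), and `w^*(Θ - θ₀) = 0`.
[cite: Deligne1982HodgeCycles, §2 Lemma 2.13] [cite: HatcherAT2002, §3.1] -/
def RationalDescent : Prop :=
  ∀ ⦃n : ℕ⦄ ⦃X : SchemeOver ℂ⦄, IsSmoothProjective n X →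
    ∀ ⦃ι : Type⦄ [Finite ι] ⦃m : ι → ℕ⦄ ⦃Y : ι → SchemeOver ℂ⦄ (h : ∀ i, Y i ⟶ X),
      (∀ i, IsSmoothProjective (m i) (Y i)) →
      ∀ ⦃nW : ℕ⦄ ⦃W : SchemeOver ℂ⦄ (w : W ⟶ X), IsSmoothProjective nW W →
        ∀ (k : ℕ), (∀ x : complexBetti X k,
            (∀ i, complexBetti.map (h i) k x = 0) → complexBetti.map w k x = 0) →
          ∀ (Θ : complexBetti X k), (∀ i, IsRationalClass (complexBetti.map (h i) k Θ)) →
            IsRationalClass (complexBetti.map w k Θ)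

/-- STATEMENT 4 — **Hodge type descends along a kernel inclusion** (THE LEVER; σ-free, curve-free
`ℂ`-linear Hodge theory on ONE smooth projective `X`): with `h_i`, `w` and `⋂ᵢ ker h_i^* ⊆ ker w^*` on
`Hᵏ(X(ℂ); ℂ)` as above, a complex class `Θ` whose pull-backs `h_i^* Θ` are all of Hodge type `(a,b)`
has `w^* Θ` of Hodge type `(a,b)`. Printed content: `Θ = ∑ π_{(c,d)} Θ` (type projectors of a Hodge
model of `X`; `HodgeModel.typeProj`, `sum_typeProj`, model by `nonempty_hodgeModel_holds`); pull-backs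
preserve types (`IsOfHodgeType.map_of_isSmoothProjective`) and type decompositions are unique
(`typeProj_eq_of_sum_eq`; off the antidiagonal a typed class is `0`), so `h_i^*(π_{(c,d)} Θ) = 0` for
`(c,d) ≠ (a,b)`; by the kernel inclusion `w^*(π_{(c,d)} Θ) = 0`, whence `w^* Θ = w^*(π_{(a,b)} Θ)` is
of type `(a,b)`. NOT claimed: that `Θ` itself is of type `(a,b)`.
[cite: VoisinHodgeI2002, Thm. 6.18, §7.1.1 and §7.3.2] -/
def TypeDescent : Prop :=
  ∀ ⦃n : ℕ⦄ ⦃X : SchemeOver ℂ⦄, IsSmoothProjective n X →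
    ∀ ⦃ι : Type⦄ [Finite ι] ⦃m : ι → ℕ⦄ ⦃Y : ι → SchemeOver ℂ⦄ (h : ∀ i, Y i ⟶ X),
      (∀ i, IsSmoothProjective (m i) (Y i)) →
      ∀ ⦃nW : ℕ⦄ ⦃W : SchemeOver ℂ⦄ (w : W ⟶ X), IsSmoothProjective nW W →
        ∀ (k a b : ℕ), (∀ x : complexBetti X k,
            (∀ i, complexBetti.map (h i) k x = 0) → complexBetti.map w k x = 0) →
          ∀ (Θ : complexBetti X k), (∀ i, IsOfHodgeType (m i) (Y i) k a b (complexBetti.map (h i) k Θ)) →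
            IsOfHodgeType nW W k a b (complexBetti.map w k Θ)

/-- STATEMENT 5 — **the fibre kernel inclusion** (TOPOLOGY; the vanishing readout): for the data of
the crux and every `σ ∈ Aut ℂ`, a class `x ∈ Hᵏ(𝒳^σ(ℂ); ℂ)` killed by all the conjugate covering pieces
`(g_i ≫ ι_o)^σ : Y_i^σ ⟶ 𝒳^σ` is killed by `ι_t^σ : X_t^σ ⟶ 𝒳^σ` for every `t` with `X_t` smooth projective
(VERBATIM statement 2 of `Lines/kernel_descent.lean`).
[cite: DeligneHodgeIII1974, Prop. 8.2.7 and Cor. 8.2.8] [cite: VoisinHodgeI2002, §9.2.1 and Thm. 9.3]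
[cite: Deligne1982HodgeCycles, §2 Thm. 2.12] -/
def FibreKernelInclusion : Prop :=
  ∀ ⦃N : ℕ⦄ ⦃𝒳 C : SchemeOver ℂ⦄ (f : 𝒳 ⟶ C) (o : AlgPoints C ℂ),
    IsSmoothProjective N 𝒳 → IsSmoothProjective 1 C → Function.Surjective f.left.base →
    ∀ ⦃ι : Type⦄ [Finite ι] ⦃m : ι → ℕ⦄ ⦃Y : ι → SchemeOver ℂ⦄ (g : ∀ i, Y i ⟶ fiberOver f o),
      (∀ i, IsSmoothProjective (m i) (Y i)) →
      (∀ x : ↥(fiberOver f o).left, ∃ (i : ι) (y : ↥(Y i).left), (g i).left.base y = x) →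
      ∀ (σ : ℂ ≃+* ℂ) (k : ℕ) (x : complexBetti (conjugateVariety σ 𝒳) k),
        (∀ i, complexBetti.map (conjHom σ (g i ≫ fiberι f o)) k x = 0) →
        ∀ (t : AlgPoints C ℂ) ⦃n : ℕ⦄, IsSmoothProjective n (fiberOver f t) →
          complexBetti.map (conjHom σ (fiberι f t)) k x = 0

/-- STATEMENT 5A (lead's reshape v3, 2026-08-17) — **conjugate fibres and conjugate coverings**
(σ-BOOKKEEPING of statement 5, base change along `σ ∈ Aut ℂ`): (i) the conjugate `(X_t)^σ` of a
fibre of `f : 𝒳 ⟶ C` is a fibre of the conjugate family `f^σ : 𝒳^σ ⟶ C^σ`, compatibly with the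
fibre inclusions; (ii) conjugation preserves joint surjectivity (on scheme points) of a family of
morphisms `g_i : Y_i ⟶ X` (the squares `Y_i^σ → Y_i`, `X^σ → X` are cartesian). [folklore]
[cite: Liu2002, Rem. 3.1.20] -/
def ConjugateFibre : Prop :=
  (∀ ⦃𝒳 C : SchemeOver ℂ⦄ (f : 𝒳 ⟶ C) (σ : ℂ ≃+* ℂ) (t : AlgPoints C ℂ),
      ∃ (t' : AlgPoints (conjugateVariety σ C) ℂ)
        (e : conjugateVariety σ (fiberOver f t) ≅ fiberOver (conjHom σ f) t'),
        e.hom ≫ fiberι (conjHom σ f) t' = conjHom σ (fiberι f t)) ∧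
  (∀ ⦃X : SchemeOver ℂ⦄ ⦃ι : Type⦄ ⦃Y : ι → SchemeOver ℂ⦄ (g : ∀ i, Y i ⟶ X) (σ : ℂ ≃+* ℂ),
      (∀ x : ↥X.left, ∃ (i : ι) (y : ↥(Y i).left), (g i).left.base y = x) →
      ∀ x' : ↥(conjugateVariety σ X).left,
        ∃ (i : ι) (y' : ↥(conjugateVariety σ (Y i)).left), (conjHom σ (g i)).left.base y' = x')

/-- STATEMENT 5B (lead's reshape v3) — **the smooth-fibre locus** (SCHEME THEORY of statement 5):
for `f : 𝒳 ⟶ C` surjective from a smooth projective variety onto a smooth projective curve there is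
an open `W ⊆ C` over which `f` is smooth of ONE relative dimension `d`, containing (the underlying
point of) every `ℂ`-point `t` whose fibre `X_t` is smooth projective. Printed content: `f` is flat at
the points of a smooth fibre (Matsumura 23.1 / de Jong 2.8: regular base, regular fibre, dimension
count), hence smooth there (EGA IV₄ 17.5.1, tree `mem_smoothLocus_of_flat_stalkMap_of_smooth_fiber`);
`W := C ∖ f(𝒳 ∖ sm(𝒳/C))` is open (`f` closed) with `f⁻¹W → W` smooth
(`smooth_morphismRestrict_of_preimage_le_smoothLocus`), of a single relative dimension because
`f⁻¹W` is irreducible (`exists_smoothOfRelativeDimension_of_smooth`).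
[cite: EGAIV4, Thm. 17.5.1] [cite: Matsumura1987, Thm. 23.1] -/
def SmoothFibreLocus : Prop :=
  ∀ ⦃N : ℕ⦄ ⦃𝒳 C : SchemeOver ℂ⦄ (f : 𝒳 ⟶ C), IsSmoothProjective N 𝒳 → IsSmoothProjective 1 C →
    Function.Surjective f.left.base →
    ∃ (W : C.left.Opens) (d : ℕ), SmoothOfRelativeDimension d (f.left ∣_ W) ∧
      ∀ (t : AlgPoints C ℂ) ⦃n : ℕ⦄, IsSmoothProjective n (fiberOver f t) → t.pt ∈ W

/-- STATEMENT 5C (lead's reshape v3) — **vanishing propagation** (TOPOLOGY of statement 5, σ-free):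
for `f : 𝒳 ⟶ C` as above, pieces `g_i : Y_i ⟶ X_o` (smooth projective) jointly covering the fibre
over `o`, an open `W ⊆ C` over which `f` is smooth of relative dimension `d`, and a class
`x ∈ Hᵏ(𝒳(ℂ); ℂ)` killed by every `(g_i ≫ ι_o)^*`: `x|_{X_t} = 0` for every `ℂ`-point `t` over `W`.
Printed content: (a) Hodge III 8.2.7 (tree, PROVED: `Deligne1974_ker_pullback_eq_ker_pullback_resolution_holds`)
gives an open `V ⊇ X_o(ℂ)` with `x|_V = 0`; (b) tube lemma for the proper `f(ℂ)`
(`AlgPoints.exists_isOpen_preimage_map_subset`): `x|_{X_s} = 0` for `s` in an open `U₀ ∋ o`;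
(c) Ehresmann over `W` (`exists_trivialisation_of_smoothOfRelativeDimension_morphismRestrict`,
`isHomotopicallyLocallyTrivialOn_of_trivialisations`): restrictions of global classes are flat over
`U = {s | s.pt ∈ W}`, which is connected (`ComplexPoints.isConnected_setOf_pt_mem_inter_of_isIrreducible`)
and dense (`dense_setOf_pt_not_mem`), so meets `U₀`; (d) a flat section vanishing at one point of the
connected `U` vanishes on `U` (`FibreRestrictionsLocallyConstantRank`).
[cite: DeligneHodgeIII1974, Prop. 8.2.7] [cite: VoisinHodgeI2002, §9.2.1 and Thm. 9.3]
[cite: VoisinHodgeII2003, §3.1.1] -/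
def VanishingPropagation : Prop :=
  ∀ ⦃N : ℕ⦄ ⦃𝒳 C : SchemeOver ℂ⦄ (f : 𝒳 ⟶ C) (o : AlgPoints C ℂ),
    IsSmoothProjective N 𝒳 → IsSmoothProjective 1 C → Function.Surjective f.left.base →
    ∀ ⦃ι : Type⦄ [Finite ι] ⦃m : ι → ℕ⦄ ⦃Y : ι → SchemeOver ℂ⦄ (g : ∀ i, Y i ⟶ fiberOver f o),
      (∀ i, IsSmoothProjective (m i) (Y i)) →
      (∀ x : ↥(fiberOver f o).left, ∃ (i : ι) (y : ↥(Y i).left), (g i).left.base y = x) →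
      ∀ (W : C.left.Opens) (d : ℕ), SmoothOfRelativeDimension d (f.left ∣_ W) →
      ∀ (k : ℕ) (x : complexBetti 𝒳 k),
        (∀ i, complexBetti.map (g i ≫ fiberι f o) k x = 0) →
        ∀ (t : AlgPoints C ℂ), t.pt ∈ W → complexBetti.map (fiberι f t) k x = 0

/-- The census's ARITHMETIC statement (`STRATEGY-CENSUS.md` § Decomposition; `Lines/kernel_descent.lean`
statement 1): **absoluteness descends along conjugation-stable kernel inclusions.** Proved below
from STATEMENTS 1–4 (`kernelDescent_of`). [cite: CharlesSchnell2014Notes, Def. 11.2.3 and §11.2.2] -/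
def KernelDescent : Prop :=
  ∀ ⦃n : ℕ⦄ ⦃X : SchemeOver ℂ⦄, IsSmoothProjective n X →
    ∀ ⦃ι : Type⦄ [Finite ι] ⦃m : ι → ℕ⦄ ⦃Y : ι → SchemeOver ℂ⦄ (h : ∀ i, Y i ⟶ X),
      (∀ i, IsSmoothProjective (m i) (Y i)) →
      ∀ ⦃nW : ℕ⦄ ⦃W : SchemeOver ℂ⦄ (w : W ⟶ X), IsSmoothProjective nW W →
        (∀ (σ : ℂ ≃+* ℂ) (k : ℕ) (x : complexBetti (conjugateVariety σ X) k),
          (∀ i, complexBetti.map (conjHom σ (h i)) k x = 0) →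
            complexBetti.map (conjHom σ w) k x = 0) →
        ∀ (p : ℕ) (ξ : complexBetti X (2 * p)), IsRationalClass ξ → IsOfHodgeType n X (2 * p) p p ξ →
          (∀ i, IsAbsoluteHodgeClass (m i) (Y i) p (complexBetti.map (h i) (2 * p) ξ)) →
          IsAbsoluteHodgeClass nW W p (complexBetti.map w (2 * p) ξ)

/-! ### The five registered stubs (`sorry` only here) -/

/-- STUB 1 (σ-INFRASTRUCTURE — theorem in print; L-sized in the tree; SHARED verbatim with
`Lines/birth.lean` and `Cruxes/HCOverNumberFields/Lines/birth.lean`) — **conjugates exist.** Used on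
`W = X_t` (existence conjunct of the conclusion) and on `X = 𝒳` (to name a conjugate `Ξ'` of `ξ`). Why
it might fail: only through the tree's carriers (realisations of closed algebraic forms must be
closed; the de Rham family must be natural and rationally normalised). Leans on: `ConjugationChart`,
`IsConjugateClass`, `IsAnalytification`, `exists_isAnalytification`, `exists_complexDeRhamIsoFamily`.
Size: L. [cite: Jouanolou1973, Lemme 1.5] [cite: Grothendieck1966, Thm. 1']
[cite: CharlesSchnell2014Notes, §11.2.2] -/
theorem stub_conjugate_exists :
    ∀ ⦃n : ℕ⦄ ⦃X : SchemeOver ℂ⦄, IsSmoothProjective n X →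
      ∀ (σ : ℂ ≃+* ℂ) (k : ℕ) (c : complexBetti X k), ∃ c', IsConjugateClass σ X k c c' := by
  sorry

/-- STUB 2 (σ-INFRASTRUCTURE — theorem in print; L-sized; SHARED verbatim with `Lines/birth.lean`) —
**conjugation is natural: it commutes with pull-backs and is single-valued** (Charles–Schnell
§11.2.2: all charts compute the canonical `α ↦ α^σ`; functoriality `θ_σ ∘ g^* = (g^σ)^* ∘ θ_σ`). Used
twice: `c' = (w^σ)^* Ξ'` and `(conjugate of h_i^* ξ) = (h_i^σ)^* Ξ'`. Why it might fail: a chart whose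
de Rham family were only `ℚˣ`-normalised up to a degree-dependent constant would produce a second
value — excluded by `IsAnalytification.unique` and `IsRationalDeRhamFamily`, which is what the proof
must make formal. Leans on: `ConjugationChart.Conjugates`, `conjHom`,
`Negative/ChartConjugationUniqueness.conjugates_add/_smul`. Size: L.
[cite: CharlesSchnell2014Notes, §11.2.2 (11.2.2)–(11.2.3)] [cite: Grothendieck1966, Thm. 1'] -/
theorem stub_conjugateNaturality :
    ∀ ⦃m n : ℕ⦄ ⦃Y X : SchemeOver ℂ⦄, IsSmoothProjective m Y → IsSmoothProjective n X →
      ∀ (g : Y ⟶ X) (σ : ℂ ≃+* ℂ) (k : ℕ) (c : complexBetti X k)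
        (c' : complexBetti (conjugateVariety σ X) k) (d' : complexBetti (conjugateVariety σ Y) k),
        IsConjugateClass σ X k c c' → IsConjugateClass σ Y k (complexBetti.map g k c) d' →
          d' = complexBetti.map (conjHom σ g) k c' := by
  sorry

/-- STUB 3 (LINEAR ALGEBRA — provable today; M) — **rationality descends along a kernel inclusion.**
Why plausibly true: see STATEMENT 3 (finite-dimensional `ℚ`-form, rational lift along the pieces,
`w^*(Θ - θ₀) = 0`). Why it might fail: none known (if `ι` is empty the kernel hypothesis forces
`w^* = 0` and the conclusion is `IsRationalClass 0`). Leans on: `finite_singularHomology_rat_complexPoints`,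
`exists_isRationalClass_complexBetti_map_eq` (one-morphism template), `IsRationalClass.pullback/.add/.smul`,
`map_sub`. Size: M. [cite: Deligne1982HodgeCycles, §2 Lemma 2.13] [cite: HatcherAT2002, §3.1] -/
theorem stub_rationalDescent :
    ∀ ⦃n : ℕ⦄ ⦃X : SchemeOver ℂ⦄, IsSmoothProjective n X →
      ∀ ⦃ι : Type⦄ [Finite ι] ⦃m : ι → ℕ⦄ ⦃Y : ι → SchemeOver ℂ⦄ (h : ∀ i, Y i ⟶ X),
        (∀ i, IsSmoothProjective (m i) (Y i)) →
        ∀ ⦃nW : ℕ⦄ ⦃W : SchemeOver ℂ⦄ (w : W ⟶ X), IsSmoothProjective nW W →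
          ∀ (k : ℕ), (∀ x : complexBetti X k,
              (∀ i, complexBetti.map (h i) k x = 0) → complexBetti.map w k x = 0) →
            ∀ (Θ : complexBetti X k), (∀ i, IsRationalClass (complexBetti.map (h i) k Θ)) →
              IsRationalClass (complexBetti.map w k Θ) :=
  Summit.HodgeConjecture.HodgeConjecture.Theorems.stub_rationalDescent

/-- STUB 4 (HODGE THEORY ON ONE VARIETY — provable today; M; THE LEVER) — **Hodge type descends
along a kernel inclusion.** Why plausibly true: see STATEMENT 4 (type projectors of a Hodge model of
`X`, functoriality of types under pull-back, uniqueness of type decompositions on the `Y_i`, kernel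
inclusion, `w^* Θ = w^*(π_{(a,b)} Θ)`). Why it might fail: none known (off the antidiagonal or for
`a > dim Y_i` the hypothesis forces `h_i^* Θ = 0`, and the conclusion `w^* Θ = 0` is of every type given
the Hodge model of `W` from `nonempty_hodgeModel_holds`). NOT claimed: `Θ` of type `(a,b)` on `X`.
Leans on: `HodgeModel.typeProj`, `HodgeModel.sum_typeProj`, `HodgeModel.typeProj_eq_of_sum_eq`,
`HodgeModel.typeProj_mem`, `IsOfHodgeType.map_of_isSmoothProjective`, `IsOfHodgeType.eq_zero_of_ne`,
`IsOfHodgeType.sum`, `nonempty_hodgeModel_holds`, `hodgePQ_independent_of_hodgeModel_holds`. Size: M.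
[cite: VoisinHodgeI2002, Thm. 6.18, §7.1.1 and §7.3.2] -/
theorem stub_typeDescent :
    ∀ ⦃n : ℕ⦄ ⦃X : SchemeOver ℂ⦄, IsSmoothProjective n X →
      ∀ ⦃ι : Type⦄ [Finite ι] ⦃m : ι → ℕ⦄ ⦃Y : ι → SchemeOver ℂ⦄ (h : ∀ i, Y i ⟶ X),
        (∀ i, IsSmoothProjective (m i) (Y i)) →
        ∀ ⦃nW : ℕ⦄ ⦃W : SchemeOver ℂ⦄ (w : W ⟶ X), IsSmoothProjective nW W →
          ∀ (k a b : ℕ), (∀ x : complexBetti X k,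
              (∀ i, complexBetti.map (h i) k x = 0) → complexBetti.map w k x = 0) →
            ∀ (Θ : complexBetti X k),
              (∀ i, IsOfHodgeType (m i) (Y i) k a b (complexBetti.map (h i) k Θ)) →
              IsOfHodgeType nW W k a b (complexBetti.map w k Θ) :=
  Summit.HodgeConjecture.HodgeConjecture.Theorems.stub_typeDescent

/-- STUB 5A (σ-BOOKKEEPING — provable today; M) — **conjugate fibres and conjugate coverings**: see
STATEMENT 5A. (i) `(X_t)^σ ≅ (𝒳^σ)_{t'}` over `ℂ` for the `ℂ`-point `t'` of `C^σ` corresponding to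
`t` (`(Spec ℂ)^σ ≅ Spec ℂ` composed with `t^σ`), compatibly with the fibre inclusions — base change
along `σ` is a right adjoint (`baseChangeHom = Over.pullback`) and preserves the fibre square; (ii)
conjugation preserves joint surjectivity on scheme points (the squares `Y_i^σ → Y_i` over `X^σ → X`
are cartesian, `Motives.isPullback_baseChangeHom_map_left`, and points of a fibre product with
prescribed images exist, `Scheme.Pullback.exists_preimage_pullback`). Why it might fail: none known
(pure bookkeeping). Leans on: `fiberOver`, `fiberι`, `conjugateVariety`, `conjHom`, `baseChangeHom`,
`baseChangeHomFst`, `Motives.isPullback_baseChangeHom_map_left`, `IsPullback` API. Size: M. [folklore] -/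
theorem stub_conjugateFibre :
    (∀ ⦃𝒳 C : SchemeOver ℂ⦄ (f : 𝒳 ⟶ C) (σ : ℂ ≃+* ℂ) (t : AlgPoints C ℂ),
        ∃ (t' : AlgPoints (conjugateVariety σ C) ℂ)
          (e : conjugateVariety σ (fiberOver f t) ≅ fiberOver (conjHom σ f) t'),
          e.hom ≫ fiberι (conjHom σ f) t' = conjHom σ (fiberι f t)) ∧
    (∀ ⦃X : SchemeOver ℂ⦄ ⦃ι : Type⦄ ⦃Y : ι → SchemeOver ℂ⦄ (g : ∀ i, Y i ⟶ X) (σ : ℂ ≃+* ℂ),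
        (∀ x : ↥X.left, ∃ (i : ι) (y : ↥(Y i).left), (g i).left.base y = x) →
        ∀ x' : ↥(conjugateVariety σ X).left,
          ∃ (i : ι) (y' : ↥(conjugateVariety σ (Y i)).left), (conjHom σ (g i)).left.base y' = x') :=
  Summit.HodgeConjecture.HodgeConjecture.Theorems.stub_conjugateFibre

/-- STUB 5B (SCHEME THEORY — provable today from tree lemmas; M/L) — **the smooth-fibre locus**:
see STATEMENT 5B. Why it might fail: none known (if no fibre is smooth projective, `W = ⊥` and any
`d` works vacuously). Leans on: `Scheme.Hom.smoothLocus`, `mem_smoothLocus_of_flat_stalkMap_of_smooth_fiber`,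
`smooth_morphismRestrict_of_preimage_le_smoothLocus`, `exists_smoothOfRelativeDimension_of_smooth`,
`Literature.RingTheory.Flat.flat_of_isRegularLocalRing_of_isRegularLocalRing_fiber`,
`Dimension.ringKrullDim_stalk_add_ringKrullDim_stalk_fiber_le`, `AlgPoints.isClosedMap_map`. Size: M/L.
[cite: EGAIV4, Thm. 17.5.1] [cite: Matsumura1987, Thm. 23.1] -/
theorem stub_smoothFibreLocus :
    ∀ ⦃N : ℕ⦄ ⦃𝒳 C : SchemeOver ℂ⦄ (f : 𝒳 ⟶ C), IsSmoothProjective N 𝒳 → IsSmoothProjective 1 C →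
      Function.Surjective f.left.base →
      ∃ (W : C.left.Opens) (d : ℕ), SmoothOfRelativeDimension d (f.left ∣_ W) ∧
        ∀ (t : AlgPoints C ℂ) ⦃n : ℕ⦄, IsSmoothProjective n (fiberOver f t) → t.pt ∈ W :=
  Summit.HodgeConjecture.HodgeConjecture.Theorems.stub_smoothFibreLocus

/-- STUB 5C (TOPOLOGY — provable today from tree theorems; L) — **vanishing propagation**: see
STATEMENT 5C (Hodge III 8.2.7 + tube + Ehresmann over `W` + connectedness and density of
`{s | s.pt ∈ W}` + flatness of restricted classes). Why it might fail: none known mathematically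
(`W` empty makes it vacuous; `t` over `W` but `U₀ ∩ {s | s.pt ∈ W} = ∅` is excluded by density).
Leans on: `Deligne1974_ker_pullback_eq_ker_pullback_resolution_holds`,
`AlgPoints.exists_isOpen_preimage_map_subset`, `exists_trivialisation_of_smoothOfRelativeDimension_morphismRestrict`,
`isHomotopicallyLocallyTrivialOn_of_trivialisations`, `IsHomotopicallyLocallyTrivialOn.isCohomologicallyLocallyTrivialOn`,
`isOpen_setOf_map_fiberι_eq_zero/_ne_zero`, `mem_of_isPreconnected_of_isOpen`,
`ComplexPoints.isConnected_setOf_pt_mem_inter_of_isIrreducible`, `dense_setOf_pt_not_mem`,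
`exists_isOpen_contractibleSpace_of_chartedSpace`, `ComplexPoints.chartedSpace`. Size: L.
[cite: DeligneHodgeIII1974, Prop. 8.2.7] [cite: VoisinHodgeI2002, §9.2.1 and Thm. 9.3] -/
theorem stub_vanishingPropagation :
    ∀ ⦃N : ℕ⦄ ⦃𝒳 C : SchemeOver ℂ⦄ (f : 𝒳 ⟶ C) (o : AlgPoints C ℂ),
      IsSmoothProjective N 𝒳 → IsSmoothProjective 1 C → Function.Surjective f.left.base →
      ∀ ⦃ι : Type⦄ [Finite ι] ⦃m : ι → ℕ⦄ ⦃Y : ι → SchemeOver ℂ⦄ (g : ∀ i, Y i ⟶ fiberOver f o),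
        (∀ i, IsSmoothProjective (m i) (Y i)) →
        (∀ x : ↥(fiberOver f o).left, ∃ (i : ι) (y : ↥(Y i).left), (g i).left.base y = x) →
        ∀ (W : C.left.Opens) (d : ℕ), SmoothOfRelativeDimension d (f.left ∣_ W) →
        ∀ (k : ℕ) (x : complexBetti 𝒳 k),
          (∀ i, complexBetti.map (g i ≫ fiberι f o) k x = 0) →
          ∀ (t : AlgPoints C ℂ), t.pt ∈ W → complexBetti.map (fiberι f t) k x = 0 :=
  Summit.HodgeConjecture.HodgeConjecture.Theorems.stub_vanishingPropagation

/-! ### Statement 5 from stubs 5A–5C (lead, v3): the σ-bookkeeping is done here once -/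

/-- **STATEMENT 5 (the fibre kernel inclusion, on every conjugate family) from STUBS 5A, 5B, 5C**
(kernel-checked, no `sorry`): apply the σ-free statements 5B–5C to the conjugate family
`f^σ : 𝒳^σ ⟶ C^σ` — again a surjection from a smooth projective variety onto a smooth projective
curve (`IsSmoothProjective.conjugateVariety_holds`; surjectivity is stable under base change,
`Motives.isPullback_baseChangeHom_map_left`) whose fibre over `o^σ` is covered by the conjugate
pieces (STUB 5A (ii)) — and transport fibres along the isomorphisms `(X_t)^σ ≅ (𝒳^σ)_{t^σ}` of
STUB 5A (i). [cite: Deligne1982HodgeCycles, §2 Thm. 2.12] [cite: DeligneHodgeIII1974, Prop. 8.2.7] -/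
theorem fibreKernelInclusion_of (hA : ConjugateFibre) (hB : SmoothFibreLocus)
    (hC : VanishingPropagation) : FibreKernelInclusion := by
  intro N 𝒳 C f o h𝒳 hC₁ hf ι _ m Y g hY hcov σ k x hx t n ht
  obtain ⟨o', eo, heo⟩ := hA.1 f σ o
  obtain ⟨t', et, het⟩ := hA.1 f σ t
  -- the conjugate family is again a surjection from a smooth projective variety onto a smooth
  -- projective curve
  have h𝒳' : IsSmoothProjective N (conjugateVariety σ 𝒳) :=
    IsSmoothProjective.conjugateVariety_holds σ h𝒳
  have hC' : IsSmoothProjective 1 (conjugateVariety σ C) :=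
    IsSmoothProjective.conjugateVariety_holds σ hC₁
  have hf' : Function.Surjective (conjHom σ f).left.base := by
    haveI : Surjective f.left := ⟨hf⟩
    have hs : Surjective (conjHom σ f).left :=
      MorphismProperty.of_isPullback (P := @Surjective)
        (Literature.AlgebraicGeometry.Motives.isPullback_baseChangeHom_map_left σ.toRingHom f)
        ‹Surjective f.left›
    exact hs.surj
  -- the conjugate pieces cover the conjugate fibre
  let g' : ∀ i, conjugateVariety σ (Y i) ⟶ fiberOver (conjHom σ f) o' :=
    fun i => conjHom σ (g i) ≫ eo.hom
  have hY' : ∀ i, IsSmoothProjective (m i) (conjugateVariety σ (Y i)) := fun i =>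
    IsSmoothProjective.conjugateVariety_holds σ (hY i)
  have hcov' : ∀ x' : ↥(fiberOver (conjHom σ f) o').left,
      ∃ (i : ι) (y : ↥(conjugateVariety σ (Y i)).left), (g' i).left.base y = x' := by
    intro x'
    obtain ⟨i, y', hy'⟩ := hA.2 g σ hcov (eo.inv.left.base x')
    refine ⟨i, y', ?_⟩
    have hcomp : (g' i).left.base y' = eo.hom.left.base ((conjHom σ (g i)).left.base y') := by
      change (conjHom σ (g i) ≫ eo.hom).left.base y' = _
      simp only [Over.comp_left, Scheme.Hom.comp_base, TopCat.comp_app]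
    have hid : eo.hom.left.base (eo.inv.left.base x') = x' := by
      have h1 : (eo.inv ≫ eo.hom).left.base x' = x' := by
        rw [eo.inv_hom_id]
        simp only [Over.id_left, Scheme.Hom.id_base, TopCat.id_app]
      simpa only [Over.comp_left, Scheme.Hom.comp_base, TopCat.comp_app] using h1
    rw [hcomp, hy', hid]
  -- the hypothesis on the pieces, rewritten on the conjugate family
  have hx' : ∀ i, complexBetti.map (g' i ≫ fiberι (conjHom σ f) o') k x = 0 := by
    intro i
    have hfun : g' i ≫ fiberι (conjHom σ f) o' = conjHom σ (g i ≫ fiberι f o) := by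
      change (conjHom σ (g i) ≫ eo.hom) ≫ fiberι (conjHom σ f) o' = _
      rw [Category.assoc, heo]
      exact ((baseChangeHom σ.toRingHom).map_comp (g i) (fiberι f o)).symm
    rw [hfun]
    exact hx i
  -- the smooth-fibre locus of the conjugate family and the conjugate of the smooth fibre `X_t`
  obtain ⟨W, d, hW, hmem⟩ := hB (conjHom σ f) h𝒳' hC' hf'
  have ht' : IsSmoothProjective n (fiberOver (conjHom σ f) t') :=
    IsSmoothProjective.of_iso et (IsSmoothProjective.conjugateVariety_holds σ ht)
  have key : complexBetti.map (fiberι (conjHom σ f) t') k x = 0 :=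
    hC (conjHom σ f) o' h𝒳' hC' hf' g' hY' hcov' W d hW k x hx' t' (hmem t' ht')
  -- transport back along `(X_t)^σ ≅ (𝒳^σ)_{t'}`
  rw [← het, complexBetti.map_comp, ModuleCat.comp_apply, key, map_zero]

/-! ### Name-keyed aliases of the five statements — the hypotheses of `BoundaryAbsoluteness_of`
(device of `Lines/birth.lean`: the skeleton audit admits a hypothesis of the crux-concluding theorem
only if it is NAMED like a declared stub). -/
namespace __Registered

/-- Alias of `ConjugateExists` keyed by the registered stub name. -/
abbrev stub_conjugate_exists : Prop := ConjugateExists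
/-- Alias of `ConjugateNaturality` keyed by the registered stub name. -/
abbrev stub_conjugateNaturality : Prop := ConjugateNaturality
/-- Alias of `RationalDescent` keyed by the registered stub name. -/
abbrev stub_rationalDescent : Prop := RationalDescent
/-- Alias of `TypeDescent` keyed by the registered stub name. -/
abbrev stub_typeDescent : Prop := TypeDescent
/-- Alias of `ConjugateFibre` keyed by the registered stub name. -/
abbrev stub_conjugateFibre : Prop := ConjugateFibre
/-- Alias of `SmoothFibreLocus` keyed by the registered stub name. -/
abbrev stub_smoothFibreLocus : Prop := SmoothFibreLocus
/-- Alias of `VanishingPropagation` keyed by the registered stub name. -/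
abbrev stub_vanishingPropagation : Prop := VanishingPropagation

end __Registered

/-! ### The composition: stubs 1–4 → `KernelDescent`; `KernelDescent` + stub 5 → the crux, by name -/

/-- **ARITHMETIC HALF** (kernel-checked, no `sorry`): stubs 1–4 prove `KernelDescent`. For a conjugate
`c'` of `w^* ξ`: name a conjugate `Ξ'` of `ξ` on `X^σ` (STUB 1), put `Θ := (2πi/σ(2πi))^{-p} · Ξ'`; by
STUB 2, `c' = (w^σ)^* Ξ'` and the conjugate of `h_i^* ξ` supplied by the absoluteness hypothesis IS
`(h_i^σ)^* Ξ' = (2πi/σ(2πi))ᵖ · β_i` with `β_i` RATIONAL and OF TYPE `(p,p)` on `Y_i^σ`; so `Θ` restricts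
to `β_i` on the conjugate pieces; the conjugate varieties are smooth projective
(`IsSmoothProjective.conjugateVariety_holds`, PROVED) and the kernel inclusion holds on `X^σ` by
hypothesis, so STUB 3 makes `β := (w^σ)^* Θ` rational and STUB 4 makes it of type `(p,p)`; finally
`c' = (2πi/σ(2πi))ᵖ · β`. [cite: CharlesSchnell2014Notes, Def. 11.2.3] -/
theorem kernelDescent_of (h₁ : __Registered.stub_conjugate_exists)
    (h₂ : __Registered.stub_conjugateNaturality) (h₃ : __Registered.stub_rationalDescent)
    (h₄ : __Registered.stub_typeDescent) : KernelDescent := by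
  intro n X hX ι _ m Y h hY nW W w hW hker p ξ hξr hξh habs
  -- the `(p,p)` type of `w^* ξ` (proved tree theorem: pull-backs preserve Hodge types)
  have hpp : IsOfHodgeType nW W (2 * p) p p (complexBetti.map w (2 * p) ξ) :=
    hξh.map_of_isSmoothProjective hW hX w
  refine ⟨hξr.pullback _, hpp, fun σ => ⟨h₁ hW σ (2 * p) _, fun c' hc' => ?_⟩⟩
  -- a conjugate `Ξ'` of the class `ξ` on `X^σ`
  obtain ⟨Ξ', hΞ'⟩ := h₁ hX σ (2 * p) ξ
  -- naturality: the given conjugate of `w^* ξ` is the pull-back of `Ξ'`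
  have hc'eq : c' = complexBetti.map (conjHom σ w) (2 * p) Ξ' :=
    h₂ hW hX w σ (2 * p) ξ Ξ' c' hΞ' hc'
  -- the untwisted conjugate
  obtain ⟨Θ, hΘ⟩ : ∃ Θ : complexBetti (conjugateVariety σ X) (2 * p), Θ = (periodTwist σ p)⁻¹ • Ξ' :=
    ⟨_, rfl⟩
  have htw : periodTwist σ p ≠ 0 := periodTwist_ne_zero σ p
  -- `Θ` restricts on every conjugate piece `Y_i^σ` to the RATIONAL `(p,p)`-class `β_i`
  have hΘY : ∀ i, IsRationalClass (complexBetti.map (conjHom σ (h i)) (2 * p) Θ) ∧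
      IsOfHodgeType (m i) (conjugateVariety σ (Y i)) (2 * p) p p
        (complexBetti.map (conjHom σ (h i)) (2 * p) Θ) := by
    intro i
    obtain ⟨d, hd⟩ := ((habs i).2.2 σ).1
    obtain ⟨βi, hβi, hβiH, hdβ⟩ := ((habs i).2.2 σ).2 d hd
    have hdΞ : d = complexBetti.map (conjHom σ (h i)) (2 * p) Ξ' :=
      h₂ (hY i) hX (h i) σ (2 * p) ξ Ξ' d hΞ' hd
    have hΘi : complexBetti.map (conjHom σ (h i)) (2 * p) Θ = βi := by
      rw [hΘ, map_smul, ← hdΞ, hdβ, smul_smul, inv_mul_cancel₀ htw, one_smul]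
    rw [hΘi]
    exact ⟨hβi, hβiH⟩
  -- the conjugate varieties are smooth projective (PROVED tree theorem)
  have hX' : IsSmoothProjective n (conjugateVariety σ X) := IsSmoothProjective.conjugateVariety_holds σ hX
  have hY' : ∀ i, IsSmoothProjective (m i) (conjugateVariety σ (Y i)) := fun i =>
    IsSmoothProjective.conjugateVariety_holds σ (hY i)
  have hW' : IsSmoothProjective nW (conjugateVariety σ W) := IsSmoothProjective.conjugateVariety_holds σ hW
  -- descent along the kernel inclusion on `X^σ`, twice: rationality (STUB 3) and type (STUB 4)
  have hβ : IsRationalClass (complexBetti.map (conjHom σ w) (2 * p) Θ) :=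
    h₃ hX' (fun i => conjHom σ (h i)) hY' (conjHom σ w) hW' (2 * p) (hker σ (2 * p)) Θ
      (fun i => (hΘY i).1)
  have hβH : IsOfHodgeType nW (conjugateVariety σ W) (2 * p) p p
      (complexBetti.map (conjHom σ w) (2 * p) Θ) :=
    h₄ hX' (fun i => conjHom σ (h i)) hY' (conjHom σ w) hW' (2 * p) p p (hker σ (2 * p)) Θ
      (fun i => (hΘY i).2)
  have hc'β : c' = periodTwist σ p • complexBetti.map (conjHom σ w) (2 * p) Θ := by
    rw [hc'eq, hΘ, map_smul, smul_smul, mul_inv_cancel₀ htw, one_smul]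
  exact ⟨_, hβ, hβH, hc'β⟩

/-- **THE LINE'S COMPOSITION** (kernel-checked, no `sorry`): the crux BY NAME from the seven stubs —
`KernelDescent` (stubs 1–4, `kernelDescent_of`) at `X = 𝒳`, `h_i = g_i ≫ ι_o`, `w = ι_t`, the kernel
hypothesis on every conjugate being STATEMENT 5 (`fibreKernelInclusion_of`, stubs 5A–5C). [cite: Deligne1982HodgeCycles, §2 Thm. 2.12]
[cite: DeligneHodgeIII1974, Prop. 8.2.7] -/
theorem BoundaryAbsoluteness_of (h₁ : __Registered.stub_conjugate_exists)
    (h₂ : __Registered.stub_conjugateNaturality) : BoundaryAbsoluteness := by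
  -- stubs 3–5 are LANDED theorems (v3): only the σ-infrastructure stubs 1–2 remain hypotheses
  have hFKI : FibreKernelInclusion :=
    fibreKernelInclusion_of stub_conjugateFibre stub_smoothFibreLocus stub_vanishingPropagation
  intro N p 𝒳 C f o h𝒳 hC hf ι _ m Y g hY hcov ξ hξr hξh habs t n ht
  exact kernelDescent_of h₁ h₂ stub_rationalDescent stub_typeDescent h𝒳 (fun i => g i ≫ fiberι f o) hY
    (fiberι f t) ht (fun σ k x hx => hFKI f o h𝒳 hC hf g hY hcov σ k x hx t ht) p ξ hξr hξh habs

/-- **The crux, closed modulo exactly the two remaining (σ-infrastructure) stubs.** -/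
theorem BoundaryAbsoluteness_of_stubs : BoundaryAbsoluteness :=
  BoundaryAbsoluteness_of stub_conjugate_exists stub_conjugateNaturality

end Summit.HodgeConjecture.HodgeConjecture.Cruxes.BoundaryAbsoluteness.TypewiseReadout

end
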